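import Mathlib.LinearAlgebra.Matrix.Block
import Mathlib.LinearAlgebra.Matrix.NonsingularInverse
import Literature.Barriers.CriticalPhenomena.RigorousRGSmallParameterLocPlus
import Literature.Barriers.CriticalPhenomena.RigorousRGSmallParameterLocKernel
import HarnessLib

/-!
# `RigorousRGSmallParameter` (Slade, Theorem 1.4.1): the localisation operator `Loc_X` of
# [BS-rg-loc] — the symmetrised monomials `P̂(M)`, the triangular matrix `B` of Lemma 2.1.5,
# Definition 1.3.2 and Proposition 1.3.1

Companion ("proof architecture") file of
`Literature/Barriers/CriticalPhenomena/RigorousRGSmallParameter.lean`, assembling `…LocPlus`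
(`𝔳_+`, dual test functions) and `…LocKernel` (pairings at the points of the patch). Slade §4.2:
"We use the localisation operator `Loc` defined and studied in [BS-rg-loc] … a linear projection
map `Loc_X`"; [BBS-rg-pt] §3.2 and [BS-rg-step] §1.8.2 use it with the full space `𝒱` spanned
by the symmetrised monomials `P̂(M)`, `M ∈ ℳ_+`, the symmetric ranges (`𝒬`, Slade's `𝒰`) arising
for symmetric inputs. Following [BS-rg-loc]:

* `P(M_m) = |Σ_axes|⁻¹ Σ_Θ λ(Θ,M)ΘM` (the display before Definition 1.2.2), with `Θ_S` flipping
  the axes in `S` and `λ = (-1)^{#derivatives reversed}`; we take `P̂(M) := P(M)` and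
  `P̂_m(X) = Σ_{x∈X} P̂_{m,x}`;
* **Lemma 2.1.5 (key step)**: `B_{m',m} = ⟨P̂_{m'}(X), f_m^{(a)}⟩_0 = |X| δ_{m',m}` whenever
  `[M_{m'}] ≥ [M_m]` (`TphiPairing_phatX_dualC`; from the kernel facts (A)/(B) of `…LocKernel`,
  the sign identity `λ(Θ,M)·(-1)^{#back(ΘM)} = 1`, and `|Σ_axes| = 2^d`), hence `B` is block
  triangular for the dimension and `det B = ∏ |X|^{(block sizes)} ≠ 0` for `X ≠ ∅`;
* **Definition 1.3.2**: `Loc_X F := Σ_m (αB⁻¹)_m P̂_m(X)`, `α_m = ⟨F, f_m^{(a)}⟩_0` (the explicit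
  formula of §2.2), for `X` inside the patch of the base point `a` (`InPatch`: no wrapping around
  the torus — [BS-rg-loc]'s `F ∈ 𝒩_X`, `X ⊂ Λ'`);
* **Proposition 1.3.1**: existence `⟨Loc_X F, f_m^{(a)}⟩_0 = ⟨F, f_m^{(a)}⟩_0` for all `m ∈ 𝔳_+`
  (and on the span of the dual basis), uniqueness within `𝒱(X) = span{P̂_m(X)}`, `Loc_X` is
  linear, the identity on `𝒱(X)`, and a projection (`Loc_X ∘ Loc_X = Loc_X`, the case `X' = X`
  of Proposition 1.4.1).

Scope (stated, not hidden): the test functions are those based at the chosen point `a`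
(`f_m^{(a)}`); the independence of `Loc_X F` from `a` and from the coordinate patch
(Proposition 1.3.1(iii)), Propositions 1.4.1–1.4.4 for `X ≠ X'` and Euclidean covariance, and the
norm estimates (Propositions 1.4.5, 1.5.1) are not in this file.

Sources: D. C. Brydges, G. Slade, *A renormalisation group method. II. Approximation by local
polynomials*, J. Stat. Phys. 159 (2015) 461–491, arXiv:1403.7253 (read from the TeX source:
§1.2 (`Σ_axes`, `P(M)`, Definition 1.2.2), §1.3 (Proposition 1.3.1, Definition 1.3.2), §1.4
(first paragraph, Proposition 1.4.1), §2.1 (Lemma 2.1.5 and the proof of Proposition 1.3.1),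
§2.2 (first display: `Loc_X F = Σ_{m,m'} ⟨F,f_{m'}^{(a)}⟩_0 B⁻¹_{m',m} P̂_m(X)`)).

## What this file provides (definitions with proved properties; no named fact)

* `flipL`/`flipM` (`Θ_S`), `map_clsS_flipM`, `tordS_flipM`, `tordS_map_fwd`, `pcountS_congr`,
  `pcountS_flipM_fwd`, `sgnM_mul_self`; **`phat`** (`P̂_{m,x}`), **`phatX`** (`P̂_m(X)`),
  `contDiff_phat`, `contDiff_phatX`, `InPatch`.
* **`TphiPairing_phatX_dualC`** (Lemma 2.1.5 key step), **`Bmat`**, `Bmat_apply_of_dim_le`,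
  **`blockTriangular_Bmat`**, **`det_Bmat_ne_zero`**.
* `alphaVec`, `betaVec`, **`locX`** (Definition 1.3.2), `contDiff_locX`,
  `TphiPairing_sum_phatX_dualC`, **`TphiPairing_locX_dualC`** / `TphiPairing_locX_span`
  (Proposition 1.3.1, existence), **`eq_zero_of_TphiPairing_dualC_eq_zero`** (uniqueness),
  **`locX_sum_phatX`** (identity on `𝒱(X)`), `locX_add`, `locX_const_mul`, `locX_locX`.

## References

* [BrydgesSlade2015RGII] D. C. Brydges, G. Slade, *A renormalisation group method. II.
  Approximation by local polynomials*, J. Stat. Phys. 159 (2015) 461–491, arXiv:1403.7253 —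
  §1.2–1.4, §2.1–2.2.
* [Slade2017] G. Slade, *Critical exponents for long-range O(n) models below the upper critical
  dimension*, Commun. Math. Phys. 358 (2018) 343–436, arXiv:1611.06169 — §4.2.
-/

noncomputable section

namespace Literature.Barriers.CriticalPhenomena

namespace LongRangePhi4

namespace Loc

open Finset Tphi RGNorm LocalPoly Literature.Probability.LatticeModels Matrix
open scoped ContDiff

variable {d M n : ℕ} [NeZero M]

/-! ### Axis flips and the symmetrised monomials `P̂(M)` -/

/-- Flip the signs of the steps along the axes in `S` (the action of `Θ ∈ Σ_axes` on a
multi-index). [cite: BrydgesSlade2015RGII, §1.2 ("elements of Σ_axes act on 𝒰 by possibly reversing the signs of the unit vectors")] -/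
def flipL (S : Finset (Fin d)) (α : List (Fin d × Bool)) : List (Fin d × Bool) :=
  α.map fun s => (s.1, if s.1 ∈ S then !s.2 else s.2)

/-- The action of `Θ_S ∈ Σ_axes` on an index sequence: `M_m ↦ ΘM_m = M_{Θm}`. [cite: BrydgesSlade2015RGII, §1.2 (display defining the action M_m ↦ ΘM_m = M_{Θm})] -/
def flipM (S : Finset (Fin d)) (m'' : List (Fin n × List (Fin d × Bool))) : List (Fin n × List (Fin d × Bool)) :=
  m''.map fun c => (c.1, flipL S c.2)

omit [NeZero M] in
/-- Flips preserve the order. [folklore] -/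
@[simp] theorem length_flipL (S : Finset (Fin d)) (α : List (Fin d × Bool)) : (flipL S α).length = α.length := by
  simp [flipL]

omit [NeZero M] in
/-- Flips preserve the degree. [folklore] -/
@[simp] theorem length_flipM (S : Finset (Fin d)) (m'' : List (Fin n × List (Fin d × Bool))) :
    (flipM S m'').length = m''.length := by
  simp [flipM]

omit [NeZero M] in
/-- Flips preserve the axis classes. [folklore] -/
theorem map_clsS_flipM (S : Finset (Fin d)) (m'' : List (Fin n × List (Fin d × Bool))) :
    (flipM S m'').map clsS = m''.map clsS := by
  simp only [flipM, List.map_map]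
  refine List.map_congr_left fun c _ => ?_
  simp [clsS, flipL, Function.comp_def]

omit [NeZero M] in
/-- Flips preserve the total order. [folklore] -/
theorem tordS_flipM (S : Finset (Fin d)) (m'' : List (Fin n × List (Fin d × Bool))) :
    tordS (flipM S m'') = tordS m'' := by
  simp [tordS, flipM, Function.comp_def]

omit [NeZero M] in
/-- The total order of a forward sequence viewed as signed. [folklore] -/
theorem tordS_map_fwd (m' : List (Fin n × List (Fin d))) : tordS (m'.map fwd) = tordF m' := by
  simp [tordS, tordF, fwd, Function.comp_def]

omit [NeZero M] in
/-- The signed pattern permanent depends on the rows only through their axis classes. [folklore] -/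
theorem pcountS_congr : ∀ (m₁ m₂ : List (Fin n × List (Fin d × Bool))) (m : List (Fin n × List (Fin d))),
    m₁.map clsS = m₂.map clsS → pcountS m₁ m = pcountS m₂ m
  | [], [], _, _ => rfl
  | [], _ :: _, _, h => by simp at h
  | _ :: _, [], _, h => by simp at h
  | c₁ :: m₁, c₂ :: m₂, m, h => by
      simp only [List.map_cons, List.cons.injEq] at h
      have h1 : c₁.1 = c₂.1 := by have := congrArg Prod.fst h.1; simpa [clsS] using this
      simp only [pcountS, h.1, h1]
      refine Finset.sum_congr rfl fun k _ => ?_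
      rw [pcountS_congr m₁ m₂ _ h.2]

omit [NeZero M] in
/-- `pcountS(Θ_S m', m) = pcount(m', m)`. [folklore] -/
theorem pcountS_flipM_fwd (S : Finset (Fin d)) (m' m : List (Fin n × List (Fin d))) :
    pcountS (flipM S (m'.map fwd)) m = pcount m' m := by
  rw [pcountS_congr _ _ m (map_clsS_flipM S _), pcountS_fwd]

omit [NeZero M] in
/-- `sgn(m'')² = 1`. [folklore] -/
theorem sgnM_mul_self : ∀ m'' : List (Fin n × List (Fin d × Bool)), sgnM m'' * sgnM m'' = 1
  | [] => by simp [sgnM]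
  | c :: m'' => by
      have ih := sgnM_mul_self m''
      have hc := sgnB_mul_self c.2
      simp only [sgnM, List.map_cons, List.prod_cons] at ih ⊢
      calc sgnB c.2 * (m''.map fun c => sgnB c.2).prod * (sgnB c.2 * (m''.map fun c => sgnB c.2).prod)
          = (sgnB c.2 * sgnB c.2) * ((m''.map fun c => sgnB c.2).prod * (m''.map fun c => sgnB c.2).prod) := by ring
        _ = 1 := by rw [hc, ih, one_mul]

/-- **The symmetrised monomial `P(M_m)` at the point `x`** (the display defining `P(M)` before
Definition 1.2.2 of [BS-rg-loc]): `P(M) = |Σ_axes|⁻¹ Σ_{Θ ∈ Σ_axes} λ(Θ,M) ΘM` with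
`λ(Θ,M) = (-1)^{#derivatives of M reversed by Θ}`; here `λ(Θ_S, M_m) = sgn(Θ_S m)`. We take
`P̂(M) := P(M)`, a valid choice in Definition 1.2.2 (the claim stated after the definition of
`P(M)` and proved in §2.3 of [BS-rg-loc]). [cite: BrydgesSlade2015RGII, §1.2 (display defining P(M); Definition 1.2.2)] -/
def phat (m' : List (Fin n × List (Fin d))) (x : TorusSite d M) : (TorusSite d M → Fin n → ℝ) → ℝ :=
  fun φ => ((2 : ℝ) ^ d)⁻¹ * ∑ S : Finset (Fin d), sgnM (flipM S (m'.map fwd)) * monomial (flipM S (m'.map fwd)) x φ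

/-- **`P̂_m(X) = Σ_{x ∈ X} P̂_{m,x}`** (the polynomial `P ∈ 𝒫` evaluated on the set `X`).
[cite: BrydgesSlade2015RGII, §1.2 (display defining P(X) = Σ_{x∈X} P_x)] -/
def phatX (m' : List (Fin n × List (Fin d))) (X : Finset (TorusSite d M)) : (TorusSite d M → Fin n → ℝ) → ℝ :=
  fun φ => ∑ x ∈ X, phat m' x φ

/-- `P̂_{m,x}` is smooth. [folklore] -/
theorem contDiff_phat (m' : List (Fin n × List (Fin d))) (x : TorusSite d M) : ContDiff ℝ ∞ (phat m' x) :=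
  contDiff_const.mul (ContDiff.sum fun _ _ => contDiff_const.mul (contDiff_monomial _ x))

/-- `P̂_m(X)` is smooth. [folklore] -/
theorem contDiff_phatX (m' : List (Fin n × List (Fin d))) (X : Finset (TorusSite d M)) : ContDiff ℝ ∞ (phatX m' X) :=
  ContDiff.sum fun x _ => contDiff_phat m' x

/-- `X` lies in the patch of `a` with room `K`: all coordinates satisfy `2(|z_j(x)| + K) < M`, so
that monomials of order `≤ K` at points of `X` do not wrap around the torus ("X ⊂ Λ'" for a
coordinate patch `Λ'`). [cite: BrydgesSlade2015RGII, §1.3 (coordinate patches)] -/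
def InPatch (a : TorusSite d M) (K : ℕ) (X : Finset (TorusSite d M)) : Prop :=
  ∀ x ∈ X, ∀ j, 2 * (|coord a x j| + K) < M

/-! ### The matrix `B` of Lemma 2.1.5 and its triangularity -/

/-- **The key computation of Lemma 2.1.5 of [BS-rg-loc]**:
`B_{m',m} = ⟨P̂_{m'}(X), f_m^{(a)}⟩_0 = |X| δ_{m',m}` whenever `[M_{m'}] ≥ [M_m]`
("the matrix `B` is triangular, with `|X|` on the diagonal"). [cite: BrydgesSlade2015RGII, Lemma 2.1.5 (proof)] -/
theorem TphiPairing_phatX_dualC {pN : ℕ} {dφ dplus : ℝ} (hA : LocAdm M n pN dφ dplus) {a : TorusSite d M}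
    {X : Finset (TorusSite d M)} (hX : InPatch a ⌊dplus⌋₊ X)
    {C C' : Multiset (Fin n × Multiset (Fin d))} (hC : C ∈ vPlus d n dφ dplus) (hC' : C' ∈ vPlus d n dφ dplus)
    (hdim : dim dφ (rep C) ≤ dim dφ (rep C')) :
    TphiPairing pN (basisDir d M n) (phatX (rep C') X) 0 (dualC a C) = X.card * (if C' = C then 1 else 0) := by
  set m := rep C with hm
  set m' := rep C' with hm'
  have hb := bounds_of_mem_vbarPlus (rep_mem_vbarPlus hA.pos hC)
  have hb' := bounds_of_mem_vbarPlus (rep_mem_vbarPlus hA.pos hC')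
  have hp : m.length ≤ pN := hb.1.trans hA.deg_le
  -- expand the sums over `x ∈ X` and `S`
  have hexp : TphiPairing pN (basisDir d M n) (phatX m' X) 0 (dualC a C) =
      ∑ x ∈ X, ((2 : ℝ) ^ d)⁻¹ * ∑ S : Finset (Fin d), sgnM (flipM S (m'.map fwd)) *
        (((m.length.factorial : ℕ) : ℝ) / pcount m m *
          TphiPairing pN (basisDir d M n) (monomial (flipM S (m'.map fwd)) x) 0 (tensorTF (m.map (binomTF a)))) := by
    unfold phatX
    rw [TphiPairing_finset_sum pN _ X (F := fun x ψ => phat m' x ψ) (fun x _ => contDiff_phat m' x)]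
    refine Finset.sum_congr rfl fun x _ => ?_
    unfold phat
    rw [TphiPairing_const_mul pN _ (ContDiff.sum fun S _ => contDiff_const.mul (contDiff_monomial _ x))]
    congr 1
    rw [TphiPairing_finset_sum pN _ _ (F := fun S ψ => sgnM (flipM S (m'.map fwd)) * monomial (flipM S (m'.map fwd)) x ψ)
      (fun S _ => contDiff_const.mul (contDiff_monomial _ x))]
    refine Finset.sum_congr rfl fun S _ => ?_
    rw [TphiPairing_const_mul pN _ (contDiff_monomial _ x)]
    congr 1
    unfold dualC dualTF TphiPairing
    rw [pairing_smul_right]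
  rw [hexp]
  -- the value of each term
  have hterm : ∀ x ∈ X, ∀ S : Finset (Fin d),
      sgnM (flipM S (m'.map fwd)) *
        (((m.length.factorial : ℕ) : ℝ) / pcount m m *
          TphiPairing pN (basisDir d M n) (monomial (flipM S (m'.map fwd)) x) 0 (tensorTF (m.map (binomTF a)))) =
      pcount m' m / pcount m m := by
    intro x hx S
    have hv : ∀ c'' ∈ flipM S (m'.map fwd), ∀ j, 2 * (|coord a x j| + c''.2.length) < M := by
      intro c'' hc'' j
      simp only [flipM, fwd, List.map_map, List.mem_map, Function.comp_apply] at hc''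
      obtain ⟨c, hc, rfl⟩ := hc''
      have h1 := hb'.2 c hc
      have h2 := hX x hx j
      simp only [length_flipL, List.length_map]
      have : (c.2.length : ℤ) ≤ ⌊dplus⌋₊ := by exact_mod_cast h1
      linarith
    rw [← offsetPtZ_coord a x]
    by_cases hlen : m'.length = m.length
    · have hdim' : tordF m ≤ tordF m' := by
        unfold dim at hdim
        rw [hlen] at hdim
        unfold tordF
        exact_mod_cast (add_le_add_iff_left _).1 hdim
      rcases hdim'.lt_or_eq with hlt | heq
      · -- kernel (A): too many derivatives
        rw [TphiPairing_monomial_offsetPtZ_eq_zero hA.one_le a _ _ m hv hp (by rw [tordS_flipM, tordS_map_fwd]; exact hlt)]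
        have h0 : pcount m' m = 0 := by
          by_contra h0
          have hperm := perm_of_pcount_ne_zero m' m h0
          have hsum : tordF m' = tordF m := by
            have := dim_eq_of_perm_cls (dφ := dφ) hperm
            unfold dim at this; rw [hlen] at this
            unfold tordF
            exact_mod_cast add_left_cancel this
          omega
        rw [h0]; simp
      · -- kernel (B): the diagonal computation
        rw [TphiPairing_monomial_offsetPtZ_of_eq hA.one_le a _ _ m hv hp (by rw [length_flipM, List.length_map, hlen])
          (by rw [tordS_flipM, tordS_map_fwd]; exact heq.symm), pcountS_flipM_fwd]
        have h0 : ((m.length.factorial : ℕ) : ℝ) ≠ 0 := by positivity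
        have hs := sgnM_mul_self (flipM S (m'.map fwd))
        calc sgnM (flipM S (m'.map fwd)) * (((m.length.factorial : ℕ) : ℝ) / pcount m m *
              ((((m.length.factorial : ℕ) : ℝ))⁻¹ * (sgnM (flipM S (m'.map fwd)) * pcount m' m)))
            = (sgnM (flipM S (m'.map fwd)) * sgnM (flipM S (m'.map fwd))) *
                (((m.length.factorial : ℕ) : ℝ) * (((m.length.factorial : ℕ) : ℝ))⁻¹) * (pcount m' m / pcount m m) := by ring
          _ = pcount m' m / pcount m m := by rw [hs, mul_inv_cancel₀ h0]; ring
    · -- different degrees: the pairing vanishes, and so does `pcount m' m`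
      have hc := TphiPairing_monomial_zero_congr pN (flipM S (m'.map fwd)) (offsetPtZ a fun j => coord a x j)
        (g := tensorTF (m.map (binomTF a))) (g' := fun _ => 0)
        (fun w hw => tensorTF_eq_zero_of_length _ w (by simp at hw ⊢; omega))
      unfold TphiPairing at hc ⊢
      rw [hc, pairing_zero_right]
      have h0 : pcount m' m = 0 := by
        by_contra h0
        have := (perm_of_pcount_ne_zero m' m h0).length_eq
        simp at this; exact hlen this
      rw [h0]; simp
  rw [Finset.sum_congr rfl fun x hx => by rw [Finset.sum_congr rfl fun S _ => hterm x hx S]]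
  simp only [Finset.sum_const, Finset.card_univ, Fintype.card_finset, Fintype.card_fin, nsmul_eq_mul]
  push_cast
  have h2 : ((2 : ℝ) ^ d)⁻¹ * ((2 : ℝ) ^ d) = 1 := inv_mul_cancel₀ (by positivity)
  -- identify the ratio with the Kronecker delta
  have hratio : pcount m' m / pcount m m = if C' = C then 1 else 0 := by
    split_ifs with h
    · subst h
      exact div_self (by have := one_le_pcount_self m; positivity)
    · have h0 : pcount m' m = 0 := by
        by_contra h0
        exact not_perm_rep_of_ne h (perm_of_pcount_ne_zero m' m h0)
      rw [h0, zero_div]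
  rw [hratio]
  calc (X.card : ℝ) * (((2 : ℝ) ^ d)⁻¹ * ((2 : ℝ) ^ d * (if C' = C then 1 else 0)))
      = (X.card : ℝ) * ((((2 : ℝ) ^ d)⁻¹ * (2 : ℝ) ^ d) * (if C' = C then 1 else 0)) := by ring
    _ = _ := by rw [h2, one_mul]

/-- **The matrix `B_{m',m} = ⟨P̂_{m'}(X), f_m^{(a)}⟩_0` of Lemma 2.1.5**, indexed by `𝔳_+`. [cite: BrydgesSlade2015RGII, Lemma 2.1.5 (proof: "B_{m',m} = ⟨P̂_{m'}(X), f_m^{(a)}⟩_0")] -/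
def Bmat (pN : ℕ) (dφ dplus : ℝ) (a : TorusSite d M) (X : Finset (TorusSite d M)) :
    Matrix (vPlus d n dφ dplus) (vPlus d n dφ dplus) ℝ :=
  Matrix.of fun C' C => TphiPairing pN (basisDir d M n) (phatX (rep C'.1) X) 0 (dualC a C.1)

/-- The entries of `B` on and above the dimension diagonal. [cite: BrydgesSlade2015RGII, Lemma 2.1.5 (proof)] -/
theorem Bmat_apply_of_dim_le {pN : ℕ} {dφ dplus : ℝ} (hA : LocAdm M n pN dφ dplus) {a : TorusSite d M}
    {X : Finset (TorusSite d M)} (hX : InPatch a ⌊dplus⌋₊ X) (C' C : vPlus d n dφ dplus)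
    (hdim : dim dφ (rep C.1) ≤ dim dφ (rep C'.1)) :
    Bmat pN dφ dplus a X C' C = X.card * (if C' = C then 1 else 0) := by
  unfold Bmat
  rw [Matrix.of_apply, TphiPairing_phatX_dualC hA hX C.2 C'.2 hdim]
  congr 2
  exact propext Subtype.ext_iff.symm

/-- **`B` is block triangular** with respect to the dimension `[M_m]`. [cite: BrydgesSlade2015RGII, Lemma 2.1.5 (proof: "the matrix B is triangular")] -/
theorem blockTriangular_Bmat {pN : ℕ} {dφ dplus : ℝ} (hA : LocAdm M n pN dφ dplus) {a : TorusSite d M}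
    {X : Finset (TorusSite d M)} (hX : InPatch a ⌊dplus⌋₊ X) :
    (Bmat pN dφ dplus a X).BlockTriangular fun C : vPlus d n dφ dplus => dim dφ (rep C.1) := by
  intro C' C hlt
  rw [Bmat_apply_of_dim_le hA hX C' C hlt.le]
  have hne : C' ≠ C := fun h => by subst h; exact lt_irrefl _ hlt
  rw [if_neg hne, mul_zero]

/-- **`B` is invertible**: `det B = |X|^{|𝔳_+|} ≠ 0` for nonempty `X` ("with `|X|` on the
diagonal, and hence `B⁻¹` exists"). [cite: BrydgesSlade2015RGII, Lemma 2.1.5 (proof)] -/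
theorem det_Bmat_ne_zero {pN : ℕ} {dφ dplus : ℝ} (hA : LocAdm M n pN dφ dplus) {a : TorusSite d M}
    {X : Finset (TorusSite d M)} (hX : InPatch a ⌊dplus⌋₊ X) (hXne : X.Nonempty) :
    (Bmat (n := n) pN dφ dplus a X).det ≠ 0 := by
  rw [(blockTriangular_Bmat hA hX).det]
  refine Finset.prod_ne_zero_iff.2 fun k _ => ?_
  have hblock : (Bmat pN dφ dplus a X).toSquareBlock (fun C : vPlus d n dφ dplus => dim dφ (rep C.1)) k =
      (X.card : ℝ) • (1 : Matrix _ _ ℝ) := by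
    ext i j
    rw [Matrix.toSquareBlock_def, Matrix.of_apply, Bmat_apply_of_dim_le hA hX i.1 j.1 (by rw [i.2, j.2]),
      Matrix.smul_apply, Matrix.one_apply, smul_eq_mul]
    congr 1
    simp only [Subtype.ext_iff]
  rw [hblock, Matrix.det_smul, Matrix.det_one, mul_one]
  exact pow_ne_zero _ (by have := hXne.card_pos; positivity)

/-! ### `Loc_X` (Definition 1.3.2) and Proposition 1.3.1 -/

/-- The row vector `α_m = ⟨F, f_m^{(a)}⟩_0`. [cite: BrydgesSlade2015RGII, §2.1 (proof of Lemma 2.1.5: "α_m = ⟨V_{+,a}, f_m^{(a)}⟩_0") and §2.2 ("α_{m'} = ⟨F, f_{m'}^{(a)}⟩_0")] -/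
def alphaVec (pN : ℕ) (dφ dplus : ℝ) (a : TorusSite d M) (F : (TorusSite d M → Fin n → ℝ) → ℝ) :
    vPlus d n dφ dplus → ℝ :=
  fun C => TphiPairing pN (basisDir d M n) F 0 (dualC a C.1)

/-- The coefficient row vector `β = α B⁻¹`. [cite: BrydgesSlade2015RGII, Lemma 2.1.5 (proof: "β = αB⁻¹") and §2.2 (display: Loc_X F = Σ_m β_m P̂_m(X))] -/
def betaVec (pN : ℕ) (dφ dplus : ℝ) (a : TorusSite d M) (X : Finset (TorusSite d M))
    (F : (TorusSite d M → Fin n → ℝ) → ℝ) : vPlus d n dφ dplus → ℝ :=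
  Matrix.vecMul (alphaVec pN dφ dplus a F) (Bmat pN dφ dplus a X)⁻¹

/-- **Definition 1.3.2 of [BS-rg-loc] (the localisation operator)**:
`Loc_X F = V(X) = Σ_{m ∈ 𝔳_+} β_m P̂_m(X)` with `β = αB⁻¹`, `α_m = ⟨F, f_m^{(a)}⟩_0` — the
unique element of `𝒱(X)` with `⟨F, g⟩_0 = ⟨V(X), g⟩_0` for the polynomial test functions
(Proposition 1.3.1; explicit formula: display in the proof of Propositions 1.4.5 and 1.5.1 in §2.2,
`Loc_X F = Σ_{m,m'} ⟨F, f_{m'}^{(a)}⟩_0 B^{-1}_{m',m} P̂_m(X)`). [cite: BrydgesSlade2015RGII, Definition 1.3.2, Proposition 1.3.1 and §2.2 (first display of the proof of Propositions 1.4.5 and 1.5.1)] -/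
def locX (pN : ℕ) (dφ dplus : ℝ) (a : TorusSite d M) (X : Finset (TorusSite d M))
    (F : (TorusSite d M → Fin n → ℝ) → ℝ) : (TorusSite d M → Fin n → ℝ) → ℝ :=
  fun φ => ∑ C : vPlus d n dφ dplus, betaVec pN dφ dplus a X F C * phatX (rep C.1) X φ

/-- `Loc_X F ∈ 𝒩` (smooth; indeed a polynomial in the field). [folklore] -/
theorem contDiff_locX (pN : ℕ) (dφ dplus : ℝ) (a : TorusSite d M) (X : Finset (TorusSite d M))
    (F : (TorusSite d M → Fin n → ℝ) → ℝ) : ContDiff ℝ ∞ (locX pN dφ dplus a X F) :=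
  ContDiff.sum fun _ _ => contDiff_const.mul (contDiff_phatX _ X)

/-- Pairings of an element of `𝒱(X)` with the dual basis are given by `B`:
`⟨Σ_m γ_m P̂_m(X), f_{m''}^{(a)}⟩_0 = (γB)_{m''}`. [cite: BrydgesSlade2015RGII, Lemma 2.1.5 (proof)] -/
theorem TphiPairing_sum_phatX_dualC (pN : ℕ) (dφ dplus : ℝ) (a : TorusSite d M) (X : Finset (TorusSite d M))
    (γ : vPlus d n dφ dplus → ℝ) (C : vPlus d n dφ dplus) :
    TphiPairing pN (basisDir d M n) (fun φ => ∑ C' : vPlus d n dφ dplus, γ C' * phatX (rep C'.1) X φ) 0 (dualC a C.1) =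
      Matrix.vecMul γ (Bmat pN dφ dplus a X) C := by
  rw [TphiPairing_finset_sum pN _ _ (F := fun C' ψ => γ C' * phatX (rep C'.1) X ψ) (fun C' _ => contDiff_const.mul (contDiff_phatX _ X))]
  simp only [TphiPairing_const_mul pN _ (contDiff_phatX _ X), Matrix.vecMul, dotProduct, Bmat, Matrix.of_apply]

/-- **Proposition 1.3.1(i) of [BS-rg-loc] (existence)**: `⟨Loc_X F, f_m^{(a)}⟩_0 = ⟨F, f_m^{(a)}⟩_0`
for every `m ∈ 𝔳_+` (hence `⟨F, g⟩_0 = ⟨Loc_X F, g⟩_0` on the span of the dual basis: the display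
of Proposition 1.3.1 and the first display of §1.4). [cite: BrydgesSlade2015RGII, Proposition 1.3.1 and §1.4 (first display)] -/
theorem TphiPairing_locX_dualC {pN : ℕ} {dφ dplus : ℝ} (hA : LocAdm M n pN dφ dplus) {a : TorusSite d M}
    {X : Finset (TorusSite d M)} (hX : InPatch a ⌊dplus⌋₊ X) (hXne : X.Nonempty)
    (F : (TorusSite d M → Fin n → ℝ) → ℝ) (C : vPlus d n dφ dplus) :
    TphiPairing pN (basisDir d M n) (locX pN dφ dplus a X F) 0 (dualC a C.1) =
      TphiPairing pN (basisDir d M n) F 0 (dualC a C.1) := by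
  unfold locX
  rw [TphiPairing_sum_phatX_dualC]
  unfold betaVec
  rw [Matrix.vecMul_vecMul, Matrix.nonsing_inv_mul _ (isUnit_iff_ne_zero.2 (det_Bmat_ne_zero hA hX hXne)),
    Matrix.vecMul_one]
  rfl

/-- **Proposition 1.3.1(i), span form**: `⟨Loc_X F, g⟩_0 = ⟨F, g⟩_0` for every `g` in the span of
the dual basis `{f_m^{(a)}}` of `SΠ`. [cite: BrydgesSlade2015RGII, Proposition 1.3.1 (its display)] -/
theorem TphiPairing_locX_span {pN : ℕ} {dφ dplus : ℝ} (hA : LocAdm M n pN dφ dplus) {a : TorusSite d M}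
    {X : Finset (TorusSite d M)} (hX : InPatch a ⌊dplus⌋₊ X) (hXne : X.Nonempty)
    (F : (TorusSite d M → Fin n → ℝ) → ℝ) (coef : vPlus d n dφ dplus → ℝ) :
    TphiPairing pN (basisDir d M n) (locX pN dφ dplus a X F) 0 (fun z => ∑ C : vPlus d n dφ dplus, coef C * dualC a C.1 z) =
      TphiPairing pN (basisDir d M n) F 0 (fun z => ∑ C : vPlus d n dφ dplus, coef C * dualC a C.1 z) := by
  unfold TphiPairing
  rw [pairing_sum_right, pairing_sum_right]
  refine Finset.sum_congr rfl fun C _ => ?_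
  rw [pairing_smul_right, pairing_smul_right]
  have h := TphiPairing_locX_dualC hA hX hXne F C
  unfold TphiPairing at h
  rw [h]

/-- **Proposition 1.3.1(ii) of [BS-rg-loc] (uniqueness)**: an element `Σ_m γ_m P̂_m(X)` of `𝒱(X)`
whose pairings with all `f_m^{(a)}` vanish is zero (`γ = 0`). [cite: BrydgesSlade2015RGII, Proposition 1.3.1 (uniqueness, proof in §2.1 (ii))] -/
theorem eq_zero_of_TphiPairing_dualC_eq_zero {pN : ℕ} {dφ dplus : ℝ} (hA : LocAdm M n pN dφ dplus) {a : TorusSite d M}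
    {X : Finset (TorusSite d M)} (hX : InPatch a ⌊dplus⌋₊ X) (hXne : X.Nonempty)
    (γ : vPlus d n dφ dplus → ℝ)
    (h : ∀ C : vPlus d n dφ dplus,
      TphiPairing pN (basisDir d M n) (fun φ => ∑ C' : vPlus d n dφ dplus, γ C' * phatX (rep C'.1) X φ) 0 (dualC a C.1) = 0) :
    γ = 0 := by
  have hB : Matrix.vecMul γ (Bmat pN dφ dplus a X) = 0 := by
    funext C
    rw [← TphiPairing_sum_phatX_dualC, h C]
    rfl
  have h2 := congrArg (fun w => Matrix.vecMul w (Bmat pN dφ dplus a X)⁻¹) hB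
  simp only [Matrix.vecMul_vecMul, Matrix.zero_vecMul,
    Matrix.mul_nonsing_inv _ (isUnit_iff_ne_zero.2 (det_Bmat_ne_zero hA hX hXne)), Matrix.vecMul_one] at h2
  exact h2

/-- **`Loc_X` is the identity on `𝒱(X)`**: `Loc_X(Σ_m γ_m P̂_m(X)) = Σ_m γ_m P̂_m(X)`
("`Loc_X` acts as the identity on `𝒱(X)`"). [cite: BrydgesSlade2015RGII, §1.4 (first paragraph: "Loc_X acts as the identity on 𝒱(X)")] -/
theorem locX_sum_phatX {pN : ℕ} {dφ dplus : ℝ} (hA : LocAdm M n pN dφ dplus) {a : TorusSite d M}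
    {X : Finset (TorusSite d M)} (hX : InPatch a ⌊dplus⌋₊ X) (hXne : X.Nonempty) (γ : vPlus d n dφ dplus → ℝ) :
    locX pN dφ dplus a X (fun φ => ∑ C : vPlus d n dφ dplus, γ C * phatX (rep C.1) X φ) =
      fun φ => ∑ C : vPlus d n dφ dplus, γ C * phatX (rep C.1) X φ := by
  have hβ : betaVec pN dφ dplus a X (fun φ => ∑ C : vPlus d n dφ dplus, γ C * phatX (rep C.1) X φ) = γ := by
    unfold betaVec
    have hα : alphaVec pN dφ dplus a (fun φ => ∑ C : vPlus d n dφ dplus, γ C * phatX (rep C.1) X φ) =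
        Matrix.vecMul γ (Bmat pN dφ dplus a X) := by
      funext C
      exact TphiPairing_sum_phatX_dualC pN dφ dplus a X γ C
    rw [hα, Matrix.vecMul_vecMul, Matrix.mul_nonsing_inv _ (isUnit_iff_ne_zero.2 (det_Bmat_ne_zero hA hX hXne)),
      Matrix.vecMul_one]
  funext φ
  unfold locX
  rw [hβ]

/-- **`Loc_X` is linear**: additive. [cite: BrydgesSlade2015RGII, Definition 1.3.2 ("the map Loc_X : 𝒩_X → 𝒱(X) is a linear map")] -/
theorem locX_add (pN : ℕ) (dφ dplus : ℝ) (a : TorusSite d M) (X : Finset (TorusSite d M))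
    {F G : (TorusSite d M → Fin n → ℝ) → ℝ} (hF : ContDiff ℝ ∞ F) (hG : ContDiff ℝ ∞ G) :
    locX pN dφ dplus a X (fun ψ => F ψ + G ψ) = fun φ => locX pN dφ dplus a X F φ + locX pN dφ dplus a X G φ := by
  have hα : alphaVec pN dφ dplus a (fun ψ => F ψ + G ψ) = alphaVec pN dφ dplus a F + alphaVec pN dφ dplus a G := by
    funext C; exact TphiPairing_add pN _ hF hG 0 _
  funext φ
  simp only [locX, betaVec, hα, Matrix.add_vecMul, Pi.add_apply, add_mul, Finset.sum_add_distrib]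

/-- **`Loc_X` is linear**: homogeneous. [cite: BrydgesSlade2015RGII, Definition 1.3.2 ("a linear map")] -/
theorem locX_const_mul (pN : ℕ) (dφ dplus : ℝ) (a : TorusSite d M) (X : Finset (TorusSite d M))
    {F : (TorusSite d M → Fin n → ℝ) → ℝ} (hF : ContDiff ℝ ∞ F) (c : ℝ) :
    locX pN dφ dplus a X (fun ψ => c * F ψ) = fun φ => c * locX pN dφ dplus a X F φ := by
  have hα : alphaVec pN dφ dplus a (fun ψ => c * F ψ) = c • alphaVec pN dφ dplus a F := by
    funext C; exact TphiPairing_const_mul pN _ hF c 0 _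
  funext φ
  simp only [locX, betaVec, hα, Matrix.smul_vecMul, Pi.smul_apply, smul_eq_mul, mul_assoc, Finset.mul_sum]

/-- **`Loc_X` is a projection**: `Loc_X ∘ Loc_X = Loc_X` (from the identity on `𝒱(X)`), the case
`X = X'` of Proposition 1.4.1; in particular `Loc_X ∘ (Id - Loc_X) = 0`. [cite: BrydgesSlade2015RGII, Proposition 1.4.1] -/
theorem locX_locX {pN : ℕ} {dφ dplus : ℝ} (hA : LocAdm M n pN dφ dplus) {a : TorusSite d M}
    {X : Finset (TorusSite d M)} (hX : InPatch a ⌊dplus⌋₊ X) (hXne : X.Nonempty)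
    (F : (TorusSite d M → Fin n → ℝ) → ℝ) :
    locX pN dφ dplus a X (locX pN dφ dplus a X F) = locX pN dφ dplus a X F :=
  locX_sum_phatX hA hX hXne _

end Loc

end LongRangePhi4

end Literature.Barriers.CriticalPhenomena

end
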